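import Mathlib
import HarnessLib
import Summits.ResolutionOfSingularities.ResolutionOfSingularities.Theorems.WildQuotientsWildQuotientResolutionS1aAuxOfRingData
import Summits.ResolutionOfSingularities.ResolutionOfSingularities.Theorems.WildQuotientsWildQuotientResolutionS1aKillGlue

/-!
# S1a — FROM A RING-LEVEL KILL CERTIFICATE TO THE K-CONCLUSION AT ONE MODEL: the single-chart case (K-twin of `auxChartsAt_of_ringData`)

[OURS · L1 W4.5c · lead-1 g10; FRAME-STATUS rev10 §4 item 1] — NOT statements of the manuscript; counted 0; AI-level work, weaker than expert review.
Crux stmt-ResolutionOfSingularities-17941 `CyclicQuotientFourfolds`, line `s1a-logminvertex` v10, registered research stub `stub_killTouchReachAux` (its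
conclusion at ONE model: `∃ 𝒦 d, IsPrincipalCentre p M.act g₀ 𝒦 d ∧ (M.badLocus ∩ supp 𝒦_d).Nonempty`). Route-independent.

What a census KILL certificate IS, in tree vocabulary, at ONE stable affine chart `O` of a model `M` (node `(B, 𝒜, σ, e)`): a weighted centre `(f, δ, w)`
(K1′-regular, σ-adapted, homogeneous, Veronese degree `d`) WITH ITS KILL CLAUSE — i.e. `RingKillData` unpacked, the kill clause being what
`KillCert.ringKillData_of_admissible_of_irrelevant` / `ringKillData_smoothTransversalType` (p636674) produce — whose degree-`d` trace zero set on `O` is CLOSED in `M.V`,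
lies in the bad locus and is non-empty (⇔ meets the bad locus). This file proves that such a certificate gives the K-conclusion at `M`:
* ★★ `GameFrame.GModel.exists_isPrincipalCentre_touch_of_ringData` — via the principal-chart producer (the chart filtration `chartFiltration O ((trace).comap e)`,
  support = the closed zero set) and `KillGlue.exists_isPrincipalCentre_of_agree` with ONE chart (agreement is `rfl`).
So K at a model whose bad locus has a component inside ONE stable affine chart carrying a kill certificate is formal; components not inside one affine
chart (FRAME-STATUS rev10 (F3)) need the multi-chart form `KillAgreeReach`, whose agreement clause for the leaf type is `KillCert.weightedFiltration_eq_of_leaf`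
(p638258) inside one node ring.
-/

set_option linter.dupNamespace false

noncomputable section

universe u

open CategoryTheory Limits AlgebraicGeometry TopologicalSpace Topology Opposite
open Literature.AlgebraicGeometry.Resolution Literature.AlgebraicGeometry.RelativeSpec
open Summit.ResolutionOfSingularities.ResolutionOfSingularities.Theorems.WildQuotientResolution.S1
open Summit.ResolutionOfSingularities.ResolutionOfSingularities.Theorems.WildQuotientResolution.S1.NodeAtlas
open Summit.ResolutionOfSingularities.ResolutionOfSingularities.Theorems.WildQuotientResolution.S1.ProducerStep
open Summit.ResolutionOfSingularities.ResolutionOfSingularities.Theorems.WildQuotientResolution.S1.CoarseChart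
open Summit.ResolutionOfSingularities.ResolutionOfSingularities.Theorems.WildQuotientResolution.S1.ChartData
open Summit.ResolutionOfSingularities.ResolutionOfSingularities.Theorems.WildQuotientResolution.S1.KillGlue

namespace Summit.ResolutionOfSingularities.ResolutionOfSingularities.Theorems.WildQuotientResolution.S1.GameFrame.GModel

variable {p : ℕ} {X' X₁ : Scheme.{0}} {q : X' ⟶ X₁} {G : Type} [Group G] {ρ : G →* Aut X'} {g₀ : G}

/-- ★★ **A SINGLE-CHART RING KILL CERTIFICATE GIVES THE K-CONCLUSION AT THE MODEL.** On a model `M` (Noetherian base, separated), a stable affine `O` with node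
`(B, 𝒜, σ, e)` (tame; `hσp`; intertwining `g₀`) and a weighted centre `(f, δ, w)` of Veronese degree `d` (K1′-regular, σ-adapted, homogeneous, `0 < c`) WITH THE
KILL CLAUSE (principal augmentation ideal of `σʼ` on every σ-fixed chart of positive degree — e.g. from `KillCert.ringKillData_…`), whose degree-`d` trace zero set
`Z₀` on `O` is CLOSED in `M.V`, contained in `Z(M)` and NON-EMPTY. Then some principal centre of `M` has a support meeting the bad locus (indeed `= Z₀`):
the conclusion of `KillTouchReachAux` at `M`. [OURS · L1 W4.5c · FRAME-STATUS rev10 §4 (1); NOT a statement of the manuscript] -/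
theorem exists_isPrincipalCentre_touch_of_ringData [Finite G] (hp : p.Prime) (hG : ∀ g : G, g ∈ Subgroup.zpowers g₀) (M : GModel p q G ρ g₀)
    (hNB : M.HasNoetherianBase) [M.V.IsSeparated]
    (O : M.act.StableAffineOpens) (hO : IsAffineOpen O.1)
    {m : ℕ} (r : Fin m → ℕ) {B : Type} [CommRing B] (𝒜 : (Π j : Fin m, ZMod (r j)) → AddSubgroup B) [GradedRing 𝒜] (σ : B ≃+* B)
    (e : Γ(M.V, O.1) ≃+* ↥(𝒜 0)) (htame : IsTameNode p B 𝒜 σ)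
    (hσ : ∀ t : Γ(M.V, O.1), ((e ((M.act.aut g₀⁻¹).hom.appLE O.1 O.1 (O.2.1 g₀⁻¹).ge t) : ↥(𝒜 0)) : B) = σ ((e t : ↥(𝒜 0)) : B))
    {c : ℕ} (f : Fin c → B) {δ : Fin c → Π j : Fin m, ZMod (r j)} (w : Fin c → ℕ) (hc : 0 < c) (hf : ∀ i, f i ∈ 𝒜 (δ i)) (hw : ∀ i, 0 < w i)
    (hK1 : RingTheory.Sequence.IsRegular B (List.ofFn f)) (hK1' : IsRegularRing (B ⧸ Ideal.span (Set.range f)))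
    (hσJ : ∀ n : ℕ, ((weightedFiltration f w).ideal n).map (σ : B →+* B) ≤ (weightedFiltration f w).ideal n)
    {d : ℕ} (hver : VeroneseNormalised 𝒜 f w d)
    (hkill : ∀ (hp : 0 < p) (hσp : ∀ x : B, (⇑σ)^[p] x = x) (d' : ℕ) (b : ↥(𝒜 0))
      (hb : b ∈ (traceFiltration 𝒜 f w).ideal d') (hσb : σ (b : B) = b), 0 < d' →
      (augmentationIdeal (sigmaChart 𝒜 f w d' b hb σ hσJ hp hσp hσb)).IsPrincipal)
    (hZcl : IsClosed (M.V.zeroLocus (U := O.1) ((((traceFiltration 𝒜 f w).ideal d).comap (e : Γ(M.V, O.1) →+* ↥(𝒜 0)) : Ideal Γ(M.V, O.1)) :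
      Set Γ(M.V, O.1)) ∩ (O.1 : Set M.V)))
    (hZbad : M.V.zeroLocus (U := O.1) ((((traceFiltration 𝒜 f w).ideal d).comap (e : Γ(M.V, O.1) →+* ↥(𝒜 0)) : Ideal Γ(M.V, O.1)) :
      Set Γ(M.V, O.1)) ∩ (O.1 : Set M.V) ⊆ M.badLocus)
    (hZne : (M.V.zeroLocus (U := O.1) ((((traceFiltration 𝒜 f w).ideal d).comap (e : Γ(M.V, O.1) →+* ↥(𝒜 0)) : Ideal Γ(M.V, O.1)) :
      Set Γ(M.V, O.1)) ∩ (O.1 : Set M.V)).Nonempty) :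
    ∃ (𝒦 : ReesFiltration M.V) (d' : ℕ), IsPrincipalCentre p M.act g₀ 𝒦 d' ∧ (M.badLocus ∩ ((𝒦.ideal d').support : Set M.V)).Nonempty := by
  haveI : IsLocallyNoetherian M.V := M.isLocallyNoetherian
  -- the chart filtration of the trace, with its formulas
  let K : IdealFiltration Γ(M.V, O.1) := (traceFiltration 𝒜 f w).comap (e : Γ(M.V, O.1) →+* ↥(𝒜 0))
  let 𝒦₀ : ReesFiltration M.V := chartFiltration O.1 K
  have h𝒦₀O : ∀ n, (𝒦₀.filtration ⟨O.1, hO⟩).ideal n = ((traceFiltration 𝒜 f w).ideal n).comap (e : Γ(M.V, O.1) →+* ↥(𝒜 0)) := fun n =>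
    filtration_chartFiltration O.1 hO K n
  have hprin₀ : IsPrincipalCentreChart p M.act g₀ 𝒦₀ d O :=
    ⟨hO, m, r, B, inferInstance, 𝒜, inferInstance, σ, e, htame, hσ, c, f, δ, w, hc, hf, hw, hK1, hK1', hσJ, h𝒦₀O, hver, hkill⟩
  have hZcl' : IsClosed (M.V.zeroLocus (U := O.1) (K.ideal d : Set Γ(M.V, O.1)) ∩ (O.1 : Set M.V)) := hZcl
  have hsuppO : (((𝒦₀.ideal d).support : Set M.V)) ∩ (O.1 : Set M.V) =
      M.V.zeroLocus (U := O.1) (K.ideal d : Set Γ(M.V, O.1)) ∩ (O.1 : Set M.V) := by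
    rw [show (((𝒦₀.ideal d).support : Set M.V)) = M.V.zeroLocus (U := O.1) (K.ideal d : Set Γ(M.V, O.1)) ∩ (O.1 : Set M.V) by
      rw [support_chartFiltration O.1 hO K d, hZcl'.closure_eq], Set.inter_assoc, Set.inter_self]
  -- one chart, agreement `rfl`
  obtain ⟨J, hJ, hJsupp, -⟩ := exists_isPrincipalCentre_of_agree hp hG M hNB (ι := Fin 1) (fun _ => O) (fun _ => 𝒦₀) hver.1 (fun _ => hprin₀)
    (fun _ _ U _ _ n => rfl) (B := M.V.zeroLocus (U := O.1) (K.ideal d : Set Γ(M.V, O.1)) ∩ (O.1 : Set M.V)) hZcl' hZbad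
    (Set.inter_subset_right.trans (Set.subset_iUnion (fun _ : Fin 1 => ((O.1 : Set M.V))) 0)) (fun _ => by rw [hsuppO])
  obtain ⟨v, hv⟩ := hZne
  exact ⟨J, d, hJ, v, hZbad hv, by rw [hJsupp]; exact hv⟩

end Summit.ResolutionOfSingularities.ResolutionOfSingularities.Theorems.WildQuotientResolution.S1.GameFrame.GModel

end
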